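import Literature.Probability.LatticeModels.OrthogonalButterfliesCore
import Literature.Probability.LatticeModels.ButterflyLemma
import Literature.Probability.LatticeModels.ButterflyPeriodicity
import Literature.Probability.LatticeModels.AizenmanHiguchiFromCrossings
import HarnessLib

/-!
# Orthogonal butterflies (Georgii–Higuchi 2000, Lemma 4.3)

Topic `Probability/LatticeModels`. Georgii–Higuchi 2000, Lemma 4.3 (p. 1158): "**(Orthogonal
butterflies)** `𝒢`-almost surely there exist both a horizontal infinite butterfly in `π_up` and
`π_down` as well as a vertical infinite butterfly in `π_left` and `π_right`." Proof (p. 1158):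
"Suppose there exists some `μ ∈ 𝒢` having almost surely no vertical infinite butterfly. By the
first step in the proof of the butterfly lemma, it then follows that `μ = μ ∘ R_{k,vert} ∘ T` for all
`k ∈ ℤ`, and thus `μ = μ ∘ þ_hor^{-2}`. By the tail triviality, `μ` is in fact ergodic under
`þ²_hor` … By the butterfly lemma, horizontal infinite butterflies do exist, say of colour `+`"; the
core recurrence/frame argument is `OrthogonalButterfliesCore.lean`.

Here, for `β > β_c(2)` and a tail-trivial `μ ∈ 𝒢(β, 0)` under which both colours percolate
(the coexisting extremal states, the only ones for which the statement has content):

* `map_configShift_two_smul_eq_of_no_butterfly_line` — no infinite butterfly across the lines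
  `{x_i = 0}`, `{x_i = 1}` gives `þ_{2e_i}`-invariance (Step 1 of the butterfly lemma, twice);
* `exists_vertical_butterfly_of_coexistence` — there is an infinite *vertical* butterfly: some
  colour `s` percolates in both `{x₁ ≥ k}` and `{x₁ ≤ k}`, `k ∈ {0, 1}`, with probability one;
* `exists_horizontal_butterfly_of_coexistence` — the same across a horizontal line (by the
  interchange of coordinates).

In the vertical case the absence of butterflies gives, besides `þ_{2e₁}`-invariance, the
flip-reflection symmetry `μ = μ ∘ (R_{0,vert}∘T)⁻¹`, so the horizontal butterfly provided by the
butterfly lemma comes in *both* colours; this puts us in the coexistence situation of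
`measure_existsInfCluster_plus_eq_zero_of_shift_invariant`, whose conclusion `μ(E⁺) = 0`
contradicts `μ(E⁺) = 1`.

## References

* H.-O. Georgii, Y. Higuchi, *Percolation and number of phases in the two-dimensional Ising
  model*, J. Math. Phys. 41 (2000), Lemma 4.3, Lemma 3.1 [GeorgiiHiguchi2000].
-/

noncomputable section

open MeasureTheory Filter SimpleGraph
open Literature.Probability.Percolation
open scoped ENNReal

namespace Literature.Probability.LatticeModels

variable {β : ℝ} {μ : Measure (SpinConfig (Site 2))}

/-! ### Step 1 across one family of lines -/

section StepOne

/-- **No infinite butterfly across `{x_i = 0}` and `{x_i = 1}` ⇒ `þ_{2e_i}`-invariance** (Georgii–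
Higuchi 2000, proof of Lemma 4.3: "`μ = μ ∘ R_{k} ∘ T` for all `k`, and thus `μ = μ ∘ þ^{-2}`"). [cite: GeorgiiHiguchi2000, Lemma 4.3 (proof) and Lemma 3.1 (proof, Step 1)] -/
theorem map_configShift_two_smul_eq_of_no_butterfly_line (hβ : 0 ≤ β) (hμ : μ ∈ isingGibbsMeasures 2 β 0)
    (hμt : IsTailTrivial μ) (i : Fin 2)
    (hno : ∀ k : ℤ, (k = 0 ∨ k = 1) → ∀ s : ℤˣ,
      μ (existsInfClusterIn (zdGraph 2) s {x : Site 2 | k ≤ x i} ∩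
        existsInfClusterIn (zdGraph 2) s {x : Site 2 | x i ≤ k}) = 0) :
    μ.map (configShift ((2 : ℤ) • (Pi.single i 1 : Site 2))) = μ := by
  have h0 := map_conjFlipReflect_eq_of_no_butterfly hβ hμ hμt i 0 (hno 0 (Or.inl rfl) (-1)) (hno 0 (Or.inl rfl) 1)
  have h1 := map_conjFlipReflect_eq_of_no_butterfly hβ hμ hμt i 1 (hno 1 (Or.inr rfl) (-1)) (hno 1 (Or.inr rfl) 1)
  have hm : ∀ k : ℤ, Measurable (configRelabel (Site.shift (k • (Pi.single i 1 : Site 2))) ∘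
      flipRelabel (reflectCoord i).toEquiv ∘
      configRelabel (Site.shift (-(k • (Pi.single i 1 : Site 2))))) := fun k =>
    (configRelabel _).measurable.comp ((measurable_flipRelabel _).comp (configRelabel _).measurable)
  rw [configShift_eq_configRelabel, ← conjFlipReflect_one_comp_zero i, ← Measure.map_map (hm 1) (hm 0)]
  simp only [one_smul, zero_smul, neg_zero] at h0 h1 ⊢
  rw [h0, h1]

/-- **No infinite butterfly across `{x_i = 0}` ⇒ flip-reflection symmetry** `μ = μ ∘ (R_i∘T)⁻¹`
(Step 1 of the butterfly lemma). [cite: GeorgiiHiguchi2000, Lemma 3.1 (proof, Step 1)] -/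
theorem map_flipRelabel_eq_of_no_butterfly_line (hβ : 0 ≤ β) (hμ : μ ∈ isingGibbsMeasures 2 β 0)
    (hμt : IsTailTrivial μ) (i : Fin 2)
    (hno : ∀ s : ℤˣ, μ (existsInfClusterIn (zdGraph 2) s {x : Site 2 | 0 ≤ x i} ∩
        existsInfClusterIn (zdGraph 2) s {x : Site 2 | x i ≤ 0}) = 0) :
    μ.map (flipRelabel (reflectCoord i).toEquiv) = μ :=
  map_flipRelabel_eq_of_no_butterfly hβ hμ hμt i (hno (-1)) (hno 1)

end StepOne

/-! ### Transport of half-plane percolation events -/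

section Transport

/-- Percolation of the shrunk half-plane gives percolation of the half-plane. [folklore] -/
theorem ae_existsInfClusterIn_halfPlane_mono {ν : Measure (SpinConfig (Site 2))} (s : ℤˣ) {k k' : ℤ} (hk : k' ≤ k)
    (h : ∀ᵐ ω ∂ν, ∃ x, (siteCluster (zdGraph 2) (spinSites s ω ∩ halfPlane k) x).Infinite) :
    ∀ᵐ ω ∂ν, ∃ x, (siteCluster (zdGraph 2) (spinSites s ω ∩ halfPlane k') x).Infinite := by
  filter_upwards [h] with ω ⟨x, hx⟩
  have hsub : spinSites s ω ∩ halfPlane k ⊆ spinSites s ω ∩ halfPlane k' := fun z hz =>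
    ⟨hz.1, show k' ≤ z 1 from le_trans hk hz.2⟩
  exact ⟨x, hx.mono (siteCluster_mono hsub x)⟩

/-- Percolation in `{x₂ ≤ k}` is percolation in `{x₂ ≥ -k}` for the reflected configuration. [folklore] -/
theorem ae_map_reflectOne_up_of_down (s : ℤˣ) (k : ℤ)
    (h : ∀ᵐ ω ∂μ, ω ∈ existsInfClusterIn (zdGraph 2) s {x : Site 2 | x 1 ≤ k}) :
    ∀ᵐ ω ∂(μ.map (configRelabel (reflectCoord (d := 2) 1).toEquiv)),
      ∃ x, (siteCluster (zdGraph 2) (spinSites s ω ∩ halfPlane (-k)) x).Infinite := by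
  have hmeas : MeasurableSet (existsInfClusterIn (zdGraph 2) s (halfPlane (-k)) : Set (SpinConfig (Site 2))) :=
    MeasurableSet.of_tailEvents (measurableSet_tailEvents_existsInfClusterIn (G := zdGraph 2) s _)
  have : ∀ᵐ ω ∂(μ.map (configRelabel (reflectCoord (d := 2) 1).toEquiv)), ω ∈ existsInfClusterIn (zdGraph 2) s (halfPlane (-k)) := by
    rw [ae_map_iff (configRelabel _).measurable.aemeasurable
      (p := fun ω => ω ∈ existsInfClusterIn (zdGraph 2) s (halfPlane (-k))) hmeas]
    filter_upwards [h] with ω hω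
    rw [configRelabel_mem_existsInfClusterIn_iff]
    have hpre : (reflectCoord (d := 2) 1) ⁻¹' (halfPlane (-k)) = {x : Site 2 | x 1 ≤ k} := by
      ext x
      have hR1 : (reflectCoord (d := 2) 1 x) 1 = -x 1 := Rf_apply_one x
      simp only [Set.mem_preimage, halfPlane, Set.mem_setOf_eq, hR1]
      omega
    rw [hpre]; exact hω
  exact this

/-- Percolation in `{x₂ ≥ 0}` is percolation in `{x₂ ≤ 0}` … read backwards: from the reflected
measure to the measure. [folklore] -/
theorem ae_down_of_ae_map_reflectOne_up (s : ℤˣ)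
    (h : ∀ᵐ ω ∂(μ.map (configRelabel (reflectCoord (d := 2) 1).toEquiv)),
      ∃ x, (siteCluster (zdGraph 2) (spinSites s ω ∩ halfPlane 0) x).Infinite) :
    ∀ᵐ ω ∂μ, ω ∈ existsInfClusterIn (zdGraph 2) s {x : Site 2 | x 1 ≤ 0} := by
  filter_upwards [ae_of_ae_map (configRelabel _).measurable.aemeasurable h] with ω hω
  have hω' : configRelabel (reflectCoord (d := 2) 1).toEquiv ω ∈ existsInfClusterIn (zdGraph 2) s (halfPlane 0) := hω
  rw [configRelabel_mem_existsInfClusterIn_iff] at hω'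
  have hpre : (reflectCoord (d := 2) 1) ⁻¹' (halfPlane 0) = {x : Site 2 | x 1 ≤ 0} := by
    ext x
    have hR1 : (reflectCoord (d := 2) 1 x) 1 = -x 1 := Rf_apply_one x
    simp only [Set.mem_preimage, halfPlane, Set.mem_setOf_eq, hR1]
    omega
  rwa [hpre] at hω'

/-- **Percolation in `{x₂ ≥ -1}` gives percolation in `{x₂ ≥ 0}`** for a tail-trivial Gibbs
measure: the shift lemma applied to the translate `ν ∘ θ_{e₂}⁻¹`. [cite: GeorgiiHiguchi2000, Lemma 3.4] -/
theorem ae_up_zero_of_up_neg_one {ν : Measure (SpinConfig (Site 2))} (hν : ν ∈ isingGibbsMeasures 2 β 0)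
    (hνt : IsTailTrivial ν) (s : ℤˣ)
    (h : ∀ᵐ ω ∂ν, ∃ x, (siteCluster (zdGraph 2) (spinSites s ω ∩ halfPlane (-1)) x).Infinite) :
    ∀ᵐ ω ∂ν, ∃ x, (siteCluster (zdGraph 2) (spinSites s ω ∩ halfPlane 0) x).Infinite := by
  set e : Site 2 := Pi.single 1 1 with he
  have hν' : ν.map (configShift e) ∈ isingGibbsMeasures 2 β 0 := mem_isingGibbsMeasures_map_configShift hν _
  have hν't : IsTailTrivial (ν.map (configShift e)) := hνt.map_configRelabel (Site.shift _)
  have h0 : ∀ᵐ ω ∂(ν.map (configShift e)), ∃ x, (siteCluster (zdGraph 2) (spinSites s ω ∩ halfPlane 0) x).Infinite := by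
    rw [ae_exists_infinite_cluster_map_configShift_iff_lattice]
    have : (0 : ℤ) - e 1 = -1 := by simp [he]
    rw [this]; exact h
  have h1 := shift_lemma_up hν' hν't s h0
  rw [ae_exists_infinite_cluster_map_configShift_iff_lattice] at h1
  have : (1 : ℤ) - e 1 = 0 := by simp [he]
  rw [this] at h1
  exact h1

/-- **Flip-reflection symmetry exchanges the colours in the half-planes `{x₂ ≥ k}`, `{x₂ ≤ k}`**:
if `μ = μ ∘ (R_{0,vert}∘T)⁻¹` then `E^s_P` and `E^{-s}_P` have the same probability for every
`R_{0,vert}`-invariant region `P`. [cite: GeorgiiHiguchi2000, Lemma 4.3 (proof)] -/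
theorem ae_existsInfClusterIn_neg_of_flipRelabel_zero (hflip : μ.map (flipRelabel (reflectCoord (d := 2) 0).toEquiv) = μ)
    (s : ℤˣ) {P : Set (Site 2)} (hP : (reflectCoord (d := 2) 0) ⁻¹' P = P)
    (h : ∀ᵐ ω ∂μ, ω ∈ existsInfClusterIn (zdGraph 2) s P) :
    ∀ᵐ ω ∂μ, ω ∈ existsInfClusterIn (zdGraph 2) (-s) P := by
  have hFm : Measurable (flipRelabel (reflectCoord (d := 2) 0).toEquiv) := measurable_flipRelabel _
  have h' := h
  rw [← hflip] at h'
  filter_upwards [ae_of_ae_map hFm.aemeasurable h'] with ω hω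
  rw [flipRelabel_eq_neg_comp, Function.comp_apply, neg_mem_existsInfClusterIn_iff,
    configRelabel_mem_existsInfClusterIn_iff, hP] at hω
  simpa using hω

end Transport

/-! ### Lemma 4.3 -/

section Main

/-- **Georgii–Higuchi 2000, Lemma 4.3 (Orthogonal butterflies), vertical part.** For `β > β_c(2)`
and a tail-trivial `μ ∈ 𝒢(β, 0)` under which both an infinite `+`cluster and an infinite `-`cluster
exist almost surely, there is an infinite vertical butterfly: for some `k ∈ {0, 1}` and some colour
`s`, with positive (hence full) probability both `{x₁ ≥ k}` and `{x₁ ≤ k}` contain an infinite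
`s`-cluster. [cite: GeorgiiHiguchi2000, Lemma 4.3] -/
theorem exists_vertical_butterfly_of_coexistence (hβc : criticalBeta 2 < β) (hμ : μ ∈ isingGibbsMeasures 2 β 0)
    (hμt : IsTailTrivial μ) (hcoex : ∀ s : ℤˣ, μ (existsInfCluster (zdGraph 2) s) = 1) :
    ∃ k : ℤ, (k = 0 ∨ k = 1) ∧ ∃ s : ℤˣ,
      μ (existsInfClusterIn (zdGraph 2) s {x : Site 2 | k ≤ x 0} ∩
        existsInfClusterIn (zdGraph 2) s {x : Site 2 | x 0 ≤ k}) ≠ 0 := by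
  classical
  have hβ : 0 ≤ β := (criticalBeta_nonneg 2).trans hβc.le
  have hμG : IsGibbsMeasure (isingSpecification (zdGraph 2) β 0) μ := hμ
  haveI := hμG.isProbabilityMeasure
  by_contra hno
  push Not at hno
  -- Step 1: periodicity and flip-reflection symmetry
  have hinv2 := map_configShift_two_smul_eq_of_no_butterfly_line hβ hμ hμt 0 hno
  have hflip := map_flipRelabel_eq_of_no_butterfly_line hβ hμ hμt 0 (hno 0 (Or.inl rfl))
  have h2e : ((2 : ℤ) • (Pi.single 0 1 : Site 2)) = Pi.single (0 : Fin 2) (2 : ℤ) := by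
    ext i; fin_cases i <;> simp
  rw [h2e] at hinv2
  -- the butterfly lemma: a horizontal butterfly of some colour `s`
  obtain ⟨i, k, hk, s, hne⟩ := exists_infinite_butterfly hβ hμ hμt hcoex
  fin_cases i
  · exact hne (hno k hk s)
  · -- positive probability ⇒ probability one
    have htail : MeasurableSet[tailEvents (Site 2) ℤˣ]
        (existsInfClusterIn (zdGraph 2) s {x : Site 2 | k ≤ x 1} ∩ existsInfClusterIn (zdGraph 2) s {x : Site 2 | x 1 ≤ k}) :=
      (measurableSet_tailEvents_existsInfClusterIn (G := zdGraph 2) s _).inter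
        (measurableSet_tailEvents_existsInfClusterIn (G := zdGraph 2) s _)
    have hone : μ (existsInfClusterIn (zdGraph 2) s {x : Site 2 | k ≤ x 1} ∩
        existsInfClusterIn (zdGraph 2) s {x : Site 2 | x 1 ≤ k}) = 1 := (hμt _ htail).resolve_left hne
    have hae : ∀ᵐ ω ∂μ, ω ∈ existsInfClusterIn (zdGraph 2) s {x : Site 2 | k ≤ x 1} ∩
        existsInfClusterIn (zdGraph 2) s {x : Site 2 | x 1 ≤ k} := by
      have := (prob_compl_eq_zero_iff (MeasurableSet.of_tailEvents htail)).2 hone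
      filter_upwards [measure_eq_zero_iff_ae_notMem.1 this] with ω hω
      exact not_not.1 hω
    -- colour `s` percolates in `{x₂ ≥ 0}` and `{x₂ ≤ 0}`
    have hUs : ∀ᵐ ω ∂μ, ∃ x, (siteCluster (zdGraph 2) (spinSites s ω ∩ halfPlane 0) x).Infinite := by
      have h1 : ∀ᵐ ω ∂μ, ∃ x, (siteCluster (zdGraph 2) (spinSites s ω ∩ halfPlane k) x).Infinite := by
        filter_upwards [hae] with ω hω; exact hω.1
      exact ae_existsInfClusterIn_halfPlane_mono s (by rcases hk with rfl | rfl <;> norm_num) h1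
    set μR : Measure (SpinConfig (Site 2)) := μ.map (configRelabel (reflectCoord (d := 2) 1).toEquiv) with hμR
    have hμRG : μR ∈ isingGibbsMeasures 2 β 0 := IsGibbsMeasure.map_configRelabel _ (reflectCoord 1) hμG
    have hμRt : IsTailTrivial μR := hμt.map_configRelabel _
    have hDs : ∀ᵐ ω ∂μR, ∃ x, (siteCluster (zdGraph 2) (spinSites s ω ∩ halfPlane 0) x).Infinite := by
      have h1 : ∀ᵐ ω ∂μ, ω ∈ existsInfClusterIn (zdGraph 2) s {x : Site 2 | x 1 ≤ k} := by
        filter_upwards [hae] with ω hω; exact hω.2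
      have h2 := ae_map_reflectOne_up_of_down s k h1
      rcases hk with rfl | rfl
      · simpa using h2
      · exact ae_up_zero_of_up_neg_one hμRG hμRt s (by simpa using h2)
    -- … and so does the colour `-s`, by the flip-reflection symmetry
    have hP0 : (reflectCoord (d := 2) 0) ⁻¹' (halfPlane 0) = halfPlane 0 := by
      ext x; simp [halfPlane, reflectCoord_apply]
    have hP0' : (reflectCoord (d := 2) 0) ⁻¹' {x : Site 2 | x 1 ≤ 0} = {x : Site 2 | x 1 ≤ 0} := by
      ext x; simp [reflectCoord_apply]
    have hUs' : ∀ᵐ ω ∂μ, ∃ x, (siteCluster (zdGraph 2) (spinSites (-s) ω ∩ halfPlane 0) x).Infinite :=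
      ae_existsInfClusterIn_neg_of_flipRelabel_zero hflip s hP0 hUs
    have hDs' : ∀ᵐ ω ∂μR, ∃ x, (siteCluster (zdGraph 2) (spinSites (-s) ω ∩ halfPlane 0) x).Infinite := by
      have h1 := ae_down_of_ae_map_reflectOne_up s hDs
      have h2 := ae_existsInfClusterIn_neg_of_flipRelabel_zero hflip s hP0' h1
      simpa using ae_map_reflectOne_up_of_down (-s) 0 h2
    -- the core argument: no `+`percolation, contradicting coexistence
    have hcore : μ (existsInfCluster (zdGraph 2) 1) = 0 := by
      rcases Int.units_eq_one_or s with rfl | rfl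
      · exact measure_existsInfCluster_plus_eq_zero_of_shift_invariant hβc hμ hμt two_ne_zero hinv2
          hUs hUs' hDs hDs'
      · exact measure_existsInfCluster_plus_eq_zero_of_shift_invariant hβc hμ hμt two_ne_zero hinv2
          (by simpa using hUs') hUs (by simpa using hDs') hDs
    have := hcoex 1
    rw [hcore] at this
    exact zero_ne_one this

/-- Butterfly events under the interchange of coordinates: vertical lines of the transposed
measure are horizontal lines of the measure. [folklore] -/
theorem measure_map_transpose_butterfly_zero (μ : Measure (SpinConfig (Site 2))) (s : ℤˣ) (k : ℤ) :
    (μ.map (configRelabel transposeIso.toEquiv))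
        (existsInfClusterIn (zdGraph 2) s {x : Site 2 | k ≤ x 0} ∩ existsInfClusterIn (zdGraph 2) s {x : Site 2 | x 0 ≤ k}) =
      μ (existsInfClusterIn (zdGraph 2) s {x : Site 2 | k ≤ x 1} ∩ existsInfClusterIn (zdGraph 2) s {x : Site 2 | x 1 ≤ k}) := by
  have hmeas : ∀ (P : Set (Site 2)), MeasurableSet (existsInfClusterIn (zdGraph 2) s P : Set (SpinConfig (Site 2))) :=
    fun P => MeasurableSet.of_tailEvents (measurableSet_tailEvents_existsInfClusterIn (G := zdGraph 2) s P)
  rw [Measure.map_apply (configRelabel _).measurable ((hmeas _).inter (hmeas _))]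
  congr 1
  ext ω
  simp only [Set.mem_preimage, Set.mem_inter_iff, configRelabel_mem_existsInfClusterIn_iff]
  have h1 : (transposeIso : Site 2 → Site 2) ⁻¹' {x : Site 2 | k ≤ x 0} = {x : Site 2 | k ≤ x 1} := by
    ext x; simp
  have h2 : (transposeIso : Site 2 → Site 2) ⁻¹' {x : Site 2 | x 0 ≤ k} = {x : Site 2 | x 1 ≤ k} := by
    ext x; simp
  rw [h1, h2]

/-- Butterfly events under the interchange of coordinates: horizontal lines of the transposed
measure are vertical lines of the measure. [folklore] -/
theorem measure_map_transpose_butterfly_one (μ : Measure (SpinConfig (Site 2))) (s : ℤˣ) (k : ℤ) :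
    (μ.map (configRelabel transposeIso.toEquiv))
        (existsInfClusterIn (zdGraph 2) s {x : Site 2 | k ≤ x 1} ∩ existsInfClusterIn (zdGraph 2) s {x : Site 2 | x 1 ≤ k}) =
      μ (existsInfClusterIn (zdGraph 2) s {x : Site 2 | k ≤ x 0} ∩ existsInfClusterIn (zdGraph 2) s {x : Site 2 | x 0 ≤ k}) := by
  have hmeas : ∀ (P : Set (Site 2)), MeasurableSet (existsInfClusterIn (zdGraph 2) s P : Set (SpinConfig (Site 2))) :=
    fun P => MeasurableSet.of_tailEvents (measurableSet_tailEvents_existsInfClusterIn (G := zdGraph 2) s P)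
  rw [Measure.map_apply (configRelabel _).measurable ((hmeas _).inter (hmeas _))]
  congr 1
  ext ω
  simp only [Set.mem_preimage, Set.mem_inter_iff, configRelabel_mem_existsInfClusterIn_iff]
  have h1 : (transposeIso : Site 2 → Site 2) ⁻¹' {x : Site 2 | k ≤ x 1} = {x : Site 2 | k ≤ x 0} := by
    ext x; simp
  have h2 : (transposeIso : Site 2 → Site 2) ⁻¹' {x : Site 2 | x 1 ≤ k} = {x : Site 2 | x 0 ≤ k} := by
    ext x; simp
  rw [h1, h2]

/-- **Georgii–Higuchi 2000, Lemma 4.3 (Orthogonal butterflies), horizontal part** (by the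
interchange of coordinates). [cite: GeorgiiHiguchi2000, Lemma 4.3] -/
theorem exists_horizontal_butterfly_of_coexistence (hβc : criticalBeta 2 < β) (hμ : μ ∈ isingGibbsMeasures 2 β 0)
    (hμt : IsTailTrivial μ) (hcoex : ∀ s : ℤˣ, μ (existsInfCluster (zdGraph 2) s) = 1) :
    ∃ k : ℤ, (k = 0 ∨ k = 1) ∧ ∃ s : ℤˣ,
      μ (existsInfClusterIn (zdGraph 2) s {x : Site 2 | k ≤ x 1} ∩
        existsInfClusterIn (zdGraph 2) s {x : Site 2 | x 1 ≤ k}) ≠ 0 := by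
  have hμG : IsGibbsMeasure (isingSpecification (zdGraph 2) β 0) μ := hμ
  haveI := hμG.isProbabilityMeasure
  set μT : Measure (SpinConfig (Site 2)) := μ.map (configRelabel transposeIso.toEquiv) with hμT
  have hμTG : μT ∈ isingGibbsMeasures 2 β 0 := IsGibbsMeasure.map_configRelabel _ transposeIso hμG
  have hμTt : IsTailTrivial μT := hμt.map_configRelabel _
  have hcoexT : ∀ s : ℤˣ, μT (existsInfCluster (zdGraph 2) s) = 1 := by
    intro s
    have hmeas : MeasurableSet (existsInfCluster (zdGraph 2) s : Set (SpinConfig (Site 2))) :=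
      MeasurableSet.of_tailEvents (measurableSet_tailEvents_existsInfCluster (G := zdGraph 2) s)
    rw [hμT, Measure.map_apply (configRelabel _).measurable hmeas]
    have huniv : (existsInfClusterIn (zdGraph 2) s Set.univ : Set (SpinConfig (Site 2))) = existsInfCluster (zdGraph 2) s := by
      ext ω; simp only [mem_existsInfClusterIn_iff, mem_existsInfCluster_iff, Set.inter_univ]
    have : (configRelabel transposeIso.toEquiv) ⁻¹' (existsInfCluster (zdGraph 2) s : Set (SpinConfig (Site 2))) =
        existsInfCluster (zdGraph 2) s := by
      ext ω
      rw [Set.mem_preimage, ← huniv, configRelabel_mem_existsInfClusterIn_iff, Set.preimage_univ]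
    rw [this]; exact hcoex s
  obtain ⟨k, hk, s, hne⟩ := exists_vertical_butterfly_of_coexistence hβc hμTG hμTt hcoexT
  refine ⟨k, hk, s, ?_⟩
  rw [hμT, measure_map_transpose_butterfly_zero] at hne
  exact hne

end Main

end Literature.Probability.LatticeModels
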